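import Summits.BirchSwinnertonDyer.BirchSwinnertonDyer.Theorems.QuadraticBranchSignedControlThm74OfEtaExactSequences
import Literature.NumberTheory.EllipticCurves.Kobayashi2003.SignedSelmerEtaComponentFacts
import HarnessLib

/-!
# Route `QuadraticBranchSignedControl` (rung K8, cell `bsd-potss`), crux `EtaTransportSigned`
# (stmt-BirchSwinnertonDyer-19115): the held input 19584 (Kobayashi Thm. 7.4 at `η`) and the crux
# from the NAMED finer fact `Kobayashi2003.thm74proof_etaExactSequences`

WHAT. `Theorems/QuadraticBranchSignedControlThm74OfEtaExactSequences.lean` derives Kobayashi's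
Thm. 7.4 at `η` (`Kobayashi2003.thm74_etaEvenMC_iff_etaOddMC`, item 19584 `PublishedInputThm74`) and
the crux `EtaTransportSigned` from the DISPLAYED frame `hES` (the two `η`-exact sequences of the
proof of Thm. 7.4, p. 13). That frame is now the NAMED Literature fact
`Kobayashi2003.thm74proof_etaExactSequences` (`SignedSelmerEtaComponentFacts.lean` §5); this file
instantiates: `thm74_etaEvenMC_iff_etaOddMC_of_etaExactSequencesFact` (19584's fact FROM the finer
fact) and `etaTransportSigned_of_etaExactSequencesFact` (the crux from the finer fact alone).

HONEST FRAMING (cell `bsd-potss`, run/shared/lean/pub/bsd-potss/; FULL-BSD rank ≤ 1 programme):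
TOOL THEOREMS ONLY — no definition, no named fact minted, no `sorry`, axioms standard. CONDITIONAL
(`conditional-result`) on the named fact `thm74proof_etaExactSequences` (Kobayashi's Thm. 6.2 +
6.3 + (7.21) + Cor. 7.2 at `η`: Coleman maps, Kato's Euler system, Poitou–Tate; no `_holds`). The
item 19115 is NOT closed; `BSD(W, p)` is claimed for no pair; BSD is not proved by any of this.
Seat `bsd-potss-k8q-c3` (prover), g3.

References: [Kobayashi2003] Thm. 7.4 and its proof (p. 13), Thm. 7.3 (7.21), Cor. 7.2, §4 (p. 8).
-/

set_option autoImplicit false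
set_option linter.dupNamespace false

noncomputable section

open Literature.NumberTheory.EllipticCurves

namespace Summit.BirchSwinnertonDyer.BirchSwinnertonDyer.Theorems.Thm74Skeleton

/-- **Item 19584's fact FROM the finer fact**: Kobayashi's Thm. 7.4 at `η`
(`thm74_etaEvenMC_iff_etaOddMC`) follows from the two `η`-exact sequences of its proof
(`thm74proof_etaExactSequences`) by the module theory of
`thm74_etaEvenMC_iff_etaOddMC_of_exactSequences`. CONDITIONAL on the named fact.
[cite: Kobayashi2003, Thm. 7.4 and its proof (p. 13)] -/
theorem thm74_etaEvenMC_iff_etaOddMC_of_etaExactSequencesFact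
    (h : Kobayashi2003.thm74proof_etaExactSequences) :
    Kobayashi2003.thm74_etaEvenMC_iff_etaOddMC :=
  thm74_etaEvenMC_iff_etaOddMC_of_exactSequences h

/-- **The crux `EtaTransportSigned` (item 19115) from the named finer fact alone.** CONDITIONAL on
`Kobayashi2003.thm74proof_etaExactSequences`. [cite: Kobayashi2003, Thm. 7.4 and its proof (p. 13), §4 p. 8] -/
theorem etaTransportSigned_of_etaExactSequencesFact
    (h : Kobayashi2003.thm74proof_etaExactSequences) :
    Summit.BirchSwinnertonDyer.BirchSwinnertonDyer.Theses.QuadraticBranchSignedControl.EtaTransportSigned :=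
  etaTransportSigned_of_exactSequences h

end Summit.BirchSwinnertonDyer.BirchSwinnertonDyer.Theorems.Thm74Skeleton

end
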